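import Mathlib
import HarnessLib

/-! # Crux `PercNearOneGluing.AdditiveGluing` (stmt-CriticalPhenomena-4576), line `peel`, stub `stub_pairGamma` —
# tool: the discrete layer-cake reduction to DOWN-SETS of the pocket lattice (strategy (b), correlation inequalities)

Support file (`--supports stmt-CriticalPhenomena-4576`); no definitions, no named facts; pure finite combinatorics (no measure).

In the fibre calculus of the pair step every candidate inequality of the form
`Σ_W a(W) · h(W) ≥ 0`, where `W` runs over vertex sets (values of the cluster `C(s)`), the coefficients `a(W)` are fixed signed fibre
masses and `h(W) = μ(x ↔ a₀ in Wᶜ)` (or any other probability that can only DECREASE when the killed set `W` grows), is LINEAR in the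
antitone `[0,1]`-valued function `h`.  This file proves the reduction principle used in the crux evidence `CorrIneq-b.md` §3(e),(f)
((UQ) ⇒ (Q1′), (UD) ⇒ c1): **it suffices to check the inequality for the indicator of every down-closed family of vertex sets**
(`h = 1_𝒟`, `𝒟` closed under taking subsets) — because an antitone `h` with values in `[0,1]` is a convex-type combination
`h = Σ_k t_k · 1_{𝒟_k}` of indicators of its own super-level sets, which are down-closed.
* `toolLayerCake_sum_mul_nonneg`: if `0 ≤ Σ_{W ∈ 𝒟} a W` for every down-closed `𝒟 ⊆ univ`, then `0 ≤ Σ_W a W · h W` for every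
  antitone `h : Finset (Fin n) → ℝ` with `0 ≤ h`.
Proof: induction on the number of sets where `h` is positive; peel off `t · 1_{h > 0}` with `t` the least positive value.
[cite: KozmaNitzan2024, §3.2 pp. 12–14 (pocket sums); folklore (discrete layer-cake / Choquet decomposition of a monotone function)]
-/

namespace Summit.CriticalPhenomena.PercolationContinuityZ3.Theorems

open scoped BigOperators
open Finset

noncomputable section
open Classical

section ToolLayerCake

variable {n : ℕ}

/-- The support `{W | 0 < h W}` of a nonnegative antitone function on vertex sets is down-closed. [folklore] -/
theorem toolLayerCake_support_downClosed (h : Finset (Fin n) → ℝ)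
    (hanti : ∀ W W' : Finset (Fin n), W ⊆ W' → h W' ≤ h W) :
    ∀ W ∈ (univ : Finset (Finset (Fin n))).filter (fun W => 0 < h W), ∀ W' : Finset (Fin n), W' ⊆ W →
      W' ∈ (univ : Finset (Finset (Fin n))).filter (fun W => 0 < h W) := by
  intro W hW W' hW'
  simp only [mem_filter, mem_univ, true_and] at hW ⊢
  exact lt_of_lt_of_le hW (hanti W' W hW')

/-- **Discrete layer-cake reduction to down-closed families.**  Let `a : Finset (Fin n) → ℝ` be signed coefficients such that
`0 ≤ Σ_{W ∈ 𝒟} a W` for every down-closed family `𝒟` of vertex sets.  Then `0 ≤ Σ_W a W · h W` for every antitone `h ≥ 0`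
(antitone: `W ⊆ W' → h W' ≤ h W`).  Induction on `#{W | 0 < h W}`: with `t > 0` the least positive value of `h`,
`h = t·1_{h>0} + h₂` where `h₂ ≥ 0` is again antitone with smaller positive support, and `{h > 0}` is down-closed.
[folklore (discrete Choquet / layer-cake decomposition)] -/
theorem toolLayerCake_sum_mul_nonneg (a : Finset (Fin n) → ℝ)
    (hyp : ∀ 𝒟 : Finset (Finset (Fin n)), (∀ W ∈ 𝒟, ∀ W' : Finset (Fin n), W' ⊆ W → W' ∈ 𝒟) → 0 ≤ ∑ W ∈ 𝒟, a W) :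
    ∀ (h : Finset (Fin n) → ℝ), (∀ W, 0 ≤ h W) → (∀ W W' : Finset (Fin n), W ⊆ W' → h W' ≤ h W) →
      0 ≤ ∑ W, a W * h W := by
  -- induction on the size of the positive support
  suffices key : ∀ (k : ℕ) (h : Finset (Fin n) → ℝ), ((univ : Finset (Finset (Fin n))).filter (fun W => 0 < h W)).card ≤ k →
      (∀ W, 0 ≤ h W) → (∀ W W' : Finset (Fin n), W ⊆ W' → h W' ≤ h W) → 0 ≤ ∑ W, a W * h W by
    intro h h0 hanti
    exact key _ h le_rfl h0 hanti
  intro k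
  induction k with
  | zero =>
    intro h hcard h0 _
    have hzero : ∀ W, h W = 0 := by
      intro W
      have hW : W ∉ (univ : Finset (Finset (Fin n))).filter (fun W => 0 < h W) := by
        rw [Nat.le_zero, card_eq_zero] at hcard
        rw [hcard]
        exact notMem_empty W
      simp only [mem_filter, mem_univ, true_and, not_lt] at hW
      exact le_antisymm hW (h0 W)
    simp only [hzero, mul_zero, sum_const_zero, le_refl]
  | succ k ih =>
    intro h hcard h0 hanti
    set S := (univ : Finset (Finset (Fin n))).filter (fun W => 0 < h W) with hS
    by_cases hSe : S = ∅
    · -- `h ≡ 0`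
      have hzero : ∀ W, h W = 0 := by
        intro W
        have hW : W ∉ S := by rw [hSe]; exact notMem_empty W
        rw [hS] at hW
        simp only [mem_filter, mem_univ, true_and, not_lt] at hW
        exact le_antisymm hW (h0 W)
      simp only [hzero, mul_zero, sum_const_zero, le_refl]
    · -- least positive value `t`, attained at `W₀`
      have hSne : S.Nonempty := nonempty_iff_ne_empty.2 hSe
      obtain ⟨W₀, hW₀S, hW₀min⟩ := exists_min_image S h hSne
      set t := h W₀ with ht
      have htpos : 0 < t := by
        have := hW₀S
        rw [hS] at this
        simpa only [mem_filter, mem_univ, true_and] using this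
      -- the peeled function
      set h₂ : Finset (Fin n) → ℝ := fun W => if W ∈ S then h W - t else 0 with hh₂
      have hdecomp : ∀ W, h W = t * (if W ∈ S then 1 else 0) + h₂ W := by
        intro W
        by_cases hW : W ∈ S
        · simp only [hh₂, hW, if_true, mul_one]; ring
        · have : h W = 0 := by
            have hW' := hW
            rw [hS] at hW'
            simp only [mem_filter, mem_univ, true_and, not_lt] at hW'
            exact le_antisymm hW' (h0 W)
          simp only [hh₂, hW, if_false, mul_zero, add_zero, this]
      have h₂nonneg : ∀ W, 0 ≤ h₂ W := by
        intro W
        by_cases hW : W ∈ S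
        · simp only [hh₂, hW, if_true, sub_nonneg]
          exact hW₀min W hW
        · simp only [hh₂, hW, if_false, le_refl]
      have hSdown := toolLayerCake_support_downClosed h hanti
      have h₂anti : ∀ W W' : Finset (Fin n), W ⊆ W' → h₂ W' ≤ h₂ W := by
        intro W W' hWW'
        by_cases hW' : W' ∈ S
        · have hW : W ∈ S := hSdown W' hW' W hWW'
          simp only [hh₂, hW, hW', if_true, sub_le_sub_iff_right]
          exact hanti W W' hWW'
        · simp only [hh₂, hW', if_false]
          exact h₂nonneg W
      -- the positive support of `h₂` lies in `S \ {W₀}`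
      have hsupp : (univ : Finset (Finset (Fin n))).filter (fun W => 0 < h₂ W) ⊆ S.erase W₀ := by
        intro W hW
        simp only [mem_filter, mem_univ, true_and] at hW
        rw [mem_erase]
        by_cases hWS : W ∈ S
        · refine ⟨?_, hWS⟩
          rintro rfl
          simp only [hh₂, hWS, if_true, ht, sub_self, lt_self_iff_false] at hW
        · simp only [hh₂, hWS, if_false, lt_self_iff_false] at hW
      have hcard₂ : ((univ : Finset (Finset (Fin n))).filter (fun W => 0 < h₂ W)).card ≤ k := by
        have h1 := card_le_card hsupp
        have h2 : (S.erase W₀).card = S.card - 1 := card_erase_of_mem hW₀S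
        have h3 : 0 < S.card := card_pos.2 hSne
        omega
      have hrec := ih h₂ hcard₂ h₂nonneg h₂anti
      -- the down-set part
      have hD := hyp S hSdown
      have hsumS : ∑ W, a W * (if W ∈ S then (1 : ℝ) else 0) = ∑ W ∈ S, a W := by
        rw [← sum_filter_add_sum_filter_not univ (fun W => W ∈ S)]
        have e1 : ∑ W ∈ univ.filter (fun W => W ∈ S), a W * (if W ∈ S then (1 : ℝ) else 0) = ∑ W ∈ S, a W := by
          have : univ.filter (fun W : Finset (Fin n) => W ∈ S) = S := by
            ext W; simp only [mem_filter, mem_univ, true_and]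
          rw [this]
          exact sum_congr rfl fun W hW => by simp only [hW, if_true, mul_one]
        have e2 : ∑ W ∈ univ.filter (fun W => ¬ W ∈ S), a W * (if W ∈ S then (1 : ℝ) else 0) = 0 :=
          sum_eq_zero fun W hW => by
            simp only [mem_filter, mem_univ, true_and] at hW
            simp only [hW, if_false, mul_zero]
        rw [e1, e2, add_zero]
      calc (0 : ℝ) ≤ t * ∑ W ∈ S, a W + ∑ W, a W * h₂ W :=
            add_nonneg (mul_nonneg htpos.le hD) hrec
        _ = ∑ W, a W * h W := by
            rw [← hsumS, mul_sum, ← sum_add_distrib]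
            exact sum_congr rfl fun W _ => by rw [hdecomp W]; ring

/-- Registered rung `stub_toolLayerCake_b` of crux stmt-CriticalPhenomena-4576 (seat b): the layer-cake reduction
`toolLayerCake_sum_mul_nonneg` as a closed statement. [folklore] -/
theorem stub_toolLayerCake_b : ∀ (n : ℕ) (a : Finset (Fin n) → ℝ), (∀ 𝒟 : Finset (Finset (Fin n)), (∀ W ∈ 𝒟, ∀ W' : Finset (Fin n), W' ⊆ W → W' ∈ 𝒟) → 0 ≤ ∑ W ∈ 𝒟, a W) → ∀ (h : Finset (Fin n) → ℝ), (∀ W, 0 ≤ h W) → (∀ W W' : Finset (Fin n), W ⊆ W' → h W' ≤ h W) → 0 ≤ ∑ W, a W * h W :=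
  fun _ a hyp h h0 hanti => toolLayerCake_sum_mul_nonneg a hyp h h0 hanti

end ToolLayerCake

end

end Summit.CriticalPhenomena.PercolationContinuityZ3.Theorems
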